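import Mathlib
import HarnessLib

/-!
# MIXED iterated forward differences are bounded by the iterated Fréchet derivative (companion of `IteratedDifferenceDerivBound`)

Topic `Analysis/Calculus`.  For a `Cⁿ` map `f : E → F` between real normed spaces with `‖Dⁿf‖ ≤ K` everywhere, the forward
difference `Δ_v f(x) = f(x + v) − f(x)` (Mathlib's `fwdDiff v f`) is `C^{n-1}` with `‖D^{n-1}(Δ_v f)‖ ≤ K‖v‖` (the mean value
inequality applied to `D^{n-1}f`), whence by induction

  `‖(Δ_u)^a (Δ_v)^b f (x)‖ ≤ K · ‖u‖^a · ‖v‖^b`   whenever `‖D^{a+b} f‖ ≤ K`   (**`norm_fwdDiff_iter_fwdDiff_iter_le`**),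

the estimate by which the MIXED finite differences of a sampled smooth symbol on a lattice (`v = (2π/L)e_j`) are converted into
derivative bounds (Benfatto–Giuliani–Mastropietro 2006, (2.36aa): the discrete derivatives of the lattice theory are bounded by the
continuum ones).  Also the building blocks:

* `contDiff_fwdDiff`, `iteratedFDeriv_fwdDiff` (`Dⁱ(Δ_v f)(x) = Dⁱf(x+v) − Dⁱf(x)`), `norm_iteratedFDeriv_sub_le_of_succ`
  (`‖Dⁱf(x+v) − Dⁱf(x)‖ ≤ K‖v‖` when `‖D^{i+1}f‖ ≤ K`), `norm_iteratedFDeriv_fwdDiff_le`;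
* `contDiff_fwdDiff_iter`, `norm_iteratedFDeriv_fwdDiff_iter_le` (`‖Dⁱ((Δ_v)^k f)‖ ≤ K‖v‖^k` when `‖D^{i+k}f‖ ≤ K`),
  `norm_fwdDiff_iter_le`, **`norm_fwdDiff_iter_fwdDiff_iter_le`**.

Everything is proved; no definitions, no named facts. [folklore]

## Sources

G. Benfatto, A. Giuliani, V. Mastropietro, Ann. Henri Poincaré 7 (2006) 809–898, (2.36aa) (`BenfattoGiulianiMastropietro2006`);
folklore (the mean value inequality, e.g. H. Cartan, *Calcul différentiel* (1967), Thm 3.3.2).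
-/

noncomputable section

namespace Literature.Analysis.Calculus

open Set

variable {E F : Type*} [NormedAddCommGroup E] [NormedSpace ℝ E] [NormedAddCommGroup F] [NormedSpace ℝ F]

/-- `Δ_v f` is `Cⁿ` when `f` is. [cite: BenfattoGiulianiMastropietro2006, (2.36aa)] -/
theorem contDiff_fwdDiff {n : WithTop ℕ∞} {f : E → F} (hf : ContDiff ℝ n f) (v : E) : ContDiff ℝ n (fwdDiff v f) := by
  have h1 : ContDiff ℝ n (fun y => f (y + v)) := hf.comp (contDiff_id.add contDiff_const)
  exact h1.sub hf

/-- `(Δ_v)^k f` is `Cⁿ` when `f` is. [cite: BenfattoGiulianiMastropietro2006, (2.36aa)] -/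
theorem contDiff_fwdDiff_iter {n : WithTop ℕ∞} (v : E) (k : ℕ) : ∀ {f : E → F}, ContDiff ℝ n f → ContDiff ℝ n ((fwdDiff v)^[k] f) := by
  induction k with
  | zero => intro f hf; exact hf
  | succ k ih =>
    intro f hf
    rw [Function.iterate_succ_apply]
    exact ih (contDiff_fwdDiff hf v)

/-- **The derivatives of a difference are the differences of the derivatives**: `Dⁱ(Δ_v f)(x) = Dⁱf(x + v) − Dⁱf(x)` (`f ∈ Cⁱ`). [cite: BenfattoGiulianiMastropietro2006, (2.36aa)] -/
theorem iteratedFDeriv_fwdDiff {i : ℕ} {f : E → F} (hf : ContDiff ℝ i f) (v x : E) :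
    iteratedFDeriv ℝ i (fwdDiff v f) x = iteratedFDeriv ℝ i f (x + v) - iteratedFDeriv ℝ i f x := by
  have h1 : ContDiffAt ℝ i (fun y => f (y + v)) x := (hf.comp (contDiff_id.add contDiff_const)).contDiffAt
  have h2 : fwdDiff v f = (fun y => f (y + v)) - f := rfl
  rw [h2, iteratedFDeriv_sub_apply h1 hf.contDiffAt, iteratedFDeriv_comp_add_right]

/-- **The mean value inequality for `Dⁱf`**: `‖Dⁱf(x + v) − Dⁱf(x)‖ ≤ K‖v‖` when `‖D^{i+1}f‖ ≤ K` (`f ∈ C^{i+1}`). [cite: BenfattoGiulianiMastropietro2006, (2.36aa)] -/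
theorem norm_iteratedFDeriv_sub_le_of_succ {i : ℕ} {f : E → F} (hf : ContDiff ℝ (↑(i + 1 : ℕ)) f) {K : ℝ}
    (hK : ∀ y, ‖iteratedFDeriv ℝ (i + 1) f y‖ ≤ K) (x v : E) :
    ‖iteratedFDeriv ℝ i f (x + v) - iteratedFDeriv ℝ i f x‖ ≤ K * ‖v‖ := by
  have hlt : ((i : ℕ) : WithTop ℕ∞) < ((i + 1 : ℕ) : WithTop ℕ∞) := by exact_mod_cast Nat.lt_succ_self i
  have hd : Differentiable ℝ (fun y => iteratedFDeriv ℝ i f y) := hf.differentiable_iteratedFDeriv hlt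
  have hb : ∀ y ∈ (univ : Set E), ‖fderiv ℝ (fun y => iteratedFDeriv ℝ i f y) y‖ ≤ K := fun y _ => by
    rw [show (fun y => iteratedFDeriv ℝ i f y) = iteratedFDeriv ℝ i f from rfl, norm_fderiv_iteratedFDeriv]; exact hK y
  have h := Convex.norm_image_sub_le_of_norm_fderiv_le (fun y _ => hd y) hb convex_univ (mem_univ x) (mem_univ (x + v))
  rwa [add_sub_cancel_left] at h

/-- `‖Dⁱ(Δ_v f)(x)‖ ≤ K‖v‖` when `‖D^{i+1}f‖ ≤ K`. [cite: BenfattoGiulianiMastropietro2006, (2.36aa)] -/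
theorem norm_iteratedFDeriv_fwdDiff_le {i : ℕ} {f : E → F} (hf : ContDiff ℝ (↑(i + 1 : ℕ)) f) {K : ℝ}
    (hK : ∀ y, ‖iteratedFDeriv ℝ (i + 1) f y‖ ≤ K) (v x : E) :
    ‖iteratedFDeriv ℝ i (fwdDiff v f) x‖ ≤ K * ‖v‖ := by
  have hle : ((i : ℕ) : WithTop ℕ∞) ≤ ((i + 1 : ℕ) : WithTop ℕ∞) := by exact_mod_cast Nat.le_succ i
  rw [iteratedFDeriv_fwdDiff (hf.of_le hle) v x]
  exact norm_iteratedFDeriv_sub_le_of_succ hf hK x v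

/-- **`‖Dⁱ((Δ_v)^k f)‖ ≤ K‖v‖^k` when `‖D^{i+k}f‖ ≤ K`** (`f ∈ C^{i+k}`). [cite: BenfattoGiulianiMastropietro2006, (2.36aa)] -/
theorem norm_iteratedFDeriv_fwdDiff_iter_le (v : E) (i : ℕ) :
    ∀ (k : ℕ) {f : E → F} {K : ℝ}, ContDiff ℝ (↑(i + k : ℕ)) f → (∀ y, ‖iteratedFDeriv ℝ (i + k) f y‖ ≤ K) →
      ∀ x, ‖iteratedFDeriv ℝ i ((fwdDiff v)^[k] f) x‖ ≤ K * ‖v‖ ^ k := by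
  intro k
  induction k with
  | zero =>
    intro f K hf hK x
    simpa using hK x
  | succ k ih =>
    intro f K hf hK x
    -- `(Δ_v)^{k+1} f = (Δ_v)^k (Δ_v f)` and `Δ_v f` has `‖D^{i+k}(Δ_v f)‖ ≤ K‖v‖` (the index `i + (k+1)` is `(i + k) + 1`)
    rw [Function.iterate_succ_apply]
    have hfk : ContDiff ℝ (↑(i + k + 1 : ℕ)) f := hf
    have hle : ((i + k : ℕ) : WithTop ℕ∞) ≤ ((i + k + 1 : ℕ) : WithTop ℕ∞) := by exact_mod_cast Nat.le_succ _
    have hf' : ContDiff ℝ (↑(i + k : ℕ)) (fwdDiff v f) := contDiff_fwdDiff (hfk.of_le hle) v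
    have hK' : ∀ y, ‖iteratedFDeriv ℝ (i + k) (fwdDiff v f) y‖ ≤ K * ‖v‖ := fun y =>
      norm_iteratedFDeriv_fwdDiff_le hfk (fun z => hK z) v y
    have h := ih hf' hK' x
    calc ‖iteratedFDeriv ℝ i ((fwdDiff v)^[k] (fwdDiff v f)) x‖ ≤ K * ‖v‖ * ‖v‖ ^ k := h
      _ = K * ‖v‖ ^ (k + 1) := by ring

/-- **`‖(Δ_v)^k f(x)‖ ≤ K‖v‖^k` when `‖D^k f‖ ≤ K`** (`f ∈ C^k`). [cite: BenfattoGiulianiMastropietro2006, (2.36aa)] -/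
theorem norm_fwdDiff_iter_le (v : E) :
    ∀ (k : ℕ) {f : E → F} {K : ℝ}, ContDiff ℝ k f → (∀ y, ‖iteratedFDeriv ℝ k f y‖ ≤ K) →
      ∀ x, ‖(fwdDiff v)^[k] f x‖ ≤ K * ‖v‖ ^ k := by
  intro k
  induction k with
  | zero =>
    intro f K hf hK x
    simpa using hK x
  | succ k ih =>
    intro f K hf hK x
    rw [Function.iterate_succ_apply]
    have hle : ((k : ℕ) : WithTop ℕ∞) ≤ ((k + 1 : ℕ) : WithTop ℕ∞) := by exact_mod_cast Nat.le_succ _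
    have hf' : ContDiff ℝ k (fwdDiff v f) := contDiff_fwdDiff (hf.of_le hle) v
    have hK' : ∀ y, ‖iteratedFDeriv ℝ k (fwdDiff v f) y‖ ≤ K * ‖v‖ := fun y => norm_iteratedFDeriv_fwdDiff_le hf hK v y
    have h := ih hf' hK' x
    calc ‖(fwdDiff v)^[k] (fwdDiff v f) x‖ ≤ K * ‖v‖ * ‖v‖ ^ k := h
      _ = K * ‖v‖ ^ (k + 1) := by ring

/-- **Mixed differences**: `‖(Δ_u)^a ((Δ_v)^b f)(x)‖ ≤ K‖u‖^a‖v‖^b` when `‖D^{a+b} f‖ ≤ K` (`f ∈ C^{a+b}`) — the mixed finite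
differences of a sampled smooth function are bounded by its derivatives times the lattice steps. [cite: BenfattoGiulianiMastropietro2006, (2.36aa)] -/
theorem norm_fwdDiff_iter_fwdDiff_iter_le (u v : E) {K : ℝ} (a b : ℕ) {f : E → F} (hf : ContDiff ℝ (↑(a + b : ℕ)) f)
    (hK : ∀ y, ‖iteratedFDeriv ℝ (a + b) f y‖ ≤ K) (x : E) :
    ‖(fwdDiff u)^[a] ((fwdDiff v)^[b] f) x‖ ≤ K * ‖u‖ ^ a * ‖v‖ ^ b := by
  -- `g = (Δ_v)^b f` is `C^a` with `‖D^a g‖ ≤ K‖v‖^b`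
  have hle : ((a : ℕ) : WithTop ℕ∞) ≤ ((a + b : ℕ) : WithTop ℕ∞) := by exact_mod_cast Nat.le_add_right a b
  have hg : ContDiff ℝ a ((fwdDiff v)^[b] f) := contDiff_fwdDiff_iter v b (hf.of_le hle)
  have hKg : ∀ y, ‖iteratedFDeriv ℝ a ((fwdDiff v)^[b] f) y‖ ≤ K * ‖v‖ ^ b := fun y =>
    norm_iteratedFDeriv_fwdDiff_iter_le v a b hf hK y
  have h := norm_fwdDiff_iter_le u a hg hKg x
  calc ‖(fwdDiff u)^[a] ((fwdDiff v)^[b] f) x‖ ≤ K * ‖v‖ ^ b * ‖u‖ ^ a := h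
    _ = K * ‖u‖ ^ a * ‖v‖ ^ b := by ring

/-- **Three directions**: `‖(Δ_u)^a ((Δ_v)^b ((Δ_w)^c f))(x)‖ ≤ K‖u‖^a‖v‖^b‖w‖^c` when `‖D^{a+b+c} f‖ ≤ K`.
[cite: BenfattoGiulianiMastropietro2006, (2.36aa)] -/
theorem norm_fwdDiff_iter_three_le (u v w : E) {K : ℝ} (a b c : ℕ) {f : E → F} (hf : ContDiff ℝ (↑(a + b + c : ℕ)) f)
    (hK : ∀ y, ‖iteratedFDeriv ℝ (a + b + c) f y‖ ≤ K) (x : E) :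
    ‖(fwdDiff u)^[a] ((fwdDiff v)^[b] ((fwdDiff w)^[c] f)) x‖ ≤ K * ‖u‖ ^ a * ‖v‖ ^ b * ‖w‖ ^ c := by
  have hle : ((a + b : ℕ) : WithTop ℕ∞) ≤ ((a + b + c : ℕ) : WithTop ℕ∞) := by exact_mod_cast Nat.le_add_right (a + b) c
  have hg : ContDiff ℝ (↑(a + b : ℕ)) ((fwdDiff w)^[c] f) := contDiff_fwdDiff_iter w c (hf.of_le hle)
  have hKg : ∀ y, ‖iteratedFDeriv ℝ (a + b) ((fwdDiff w)^[c] f) y‖ ≤ K * ‖w‖ ^ c := fun y =>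
    norm_iteratedFDeriv_fwdDiff_iter_le w (a + b) c hf hK y
  have h := norm_fwdDiff_iter_fwdDiff_iter_le u v a b hg hKg x
  calc _ ≤ K * ‖w‖ ^ c * ‖u‖ ^ a * ‖v‖ ^ b := h
    _ = K * ‖u‖ ^ a * ‖v‖ ^ b * ‖w‖ ^ c := by ring

end Literature.Analysis.Calculus

end
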